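import Summits.ResolutionOfSingularities.ResolutionOfSingularities.Theorems.HilbertSamuelEliminationSigmaMaxModificationsCorridor3SigmaPointCompositionLength
import Literature.AlgebraicGeometry.Resolution.EmbeddedResolutionCurvesInSurfaces
import Literature.AlgebraicGeometry.Resolution.NormalCrossingsLocal
import HarnessLib

/-!
# [OURS · L1 W4.2] σ-LAYER PHASE B′ — the ℓ-GLUE (2/2): good compositions, the LEAST LENGTH `minLength` with SHORTEST FIRST CENTRES and the one-step
# DESCENT, and the snc instance `sncLength T S` = ℓ_T(X, S) with `exists_centre_sncLength_preimage_lt`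
# (res-L1-w42-plan-1 RULING v3.14-36 (IC)/(IE), CRUX-PLAN w42 v3.13b (4) «OURS glue for ℓ»; res-L1-type-o1 CUT 15:00:37Z «POINT sub-oracle = first centre
# of a shortest resolving composition over the ℓ-glue»; crux chain w42 `SigmaMaxModifications` stmt-ResolutionOfSingularities-18506 / conjunct
# `SigmaMaxModificationsCorridor3` stmt-ResolutionOfSingularities-19249; line `w_ladder` v8.3; helper of res-L1-w42-stub-1 (gen 5),
# `--supports stmt-ResolutionOfSingularities-19249 --as helper`, counted 0; part 1/2 = `…Corridor3SigmaPointCompositionLength`)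

HONEST FRAMING. OURS bookkeeping (cell res-hironaka, slot W4.2) over part 1/2 (`IsPointBlowupCompositionN`, first centre, transports), the Literature notion
`IsStrictNormalCrossingsDivisor` and the named fact F-75 `Stacks0BIC_embeddedResolutionCurvesInSurfaces` (`Literature…EmbeddedResolutionCurvesInSurfaces`,
statement only — taken as a HYPOTHESIS `hF` where used, never asserted). NOTHING here is a statement of H. Hironaka's manuscript [Hironaka2017] nor of
[CossartJannsenSaito2020]; no named fact is introduced. AI-written; AI review is weaker than expert review.

WHY (CRUX-PLAN v3.13b (4), PHASE B′ of record): the termination measure `lex(ℓ, M)` on the regular surface `D̃` uses `ℓ(D̃, S) :=` the least `n` such that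
SOME composition of `n` closed-point blow-ups makes the total transform of `S = ⋃_j supp Γ_j` (the filtered boundary traces) a strict normal crossings
divisor (F-75 ⇒ `< ∞`), and the POINT rule «if `ℓ > 0` (and `M = 0`), blow up a first centre `q` of some shortest resolving composition» needs
`ℓ(D̃′, S′) ≤ ℓ − 1` for `D̃′ =` ANY blow-up of `D̃` at `q` and `S′ = ` the total transform of `S`. That is `exists_centre_sncLength_preimage_lt` /
`IsShortestFirstCentre.sncLength_preimage_lt` below. DESIGN NOTES. (i) `ℓ` is read at SUPPORT level (`ResolvesToSnc S π := π⁻¹ S` is an snc divisor): the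
Cartier half of F-75's conclusion is not needed and would make `ℓ` depend on the scheme structure of the traces. (ii) The LOCUS `T` of the centres is a
parameter: with `T = S` the upstairs locus `π₁⁻¹ T` is again the upstairs configuration `π₁⁻¹ S` — and the new exceptional curve lies INSIDE it because
`q ∈ S` — so the measure is read identically at the next state; the nonemptiness premise for `T = S` is the locus form of Stacks 0BIC («all centres lie over
`Z`», desk label F-75c, running text of Tags 0BIB/0BIC — requested, not typed here), while for `T = univ` it is F-75 itself
(`exists_existsPointCompositionN_univ_of_stacks0BIC`). (iii) The abstract form (`minLength T P`, `P` an iso-stable property of `X`-schemes) is kept so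
that another resolving predicate plugs in unchanged.

## Contents (namespace `…Theorems.SigmaMaxModificationsCorridor3.Sigma`)

* §4 PROPERTIES OF `X`-SCHEMES: `OverPred X`, `OverPred.restrict P π₁` (`π' ↦ P (π' ≫ π₁)`, `restrict_restrict`), `OverPred.IsoStable` (`.iff`, `.restrict`);
  `ExistsPointCompositionN T P n` (∃ a length-`n` composition over `T` whose composite has `P`) with `zero_iff` (`↔ P (𝟙 X)`), `mono`, `succ_iff`
  (first-centre form), `of_restrict`, `transport` (base iso), `of_isBlowup_of_isBlowup` (change of the model of the first blow-up, `IsBlowup.unique`).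
* §5 THE LEAST LENGTH `minLength T P := sInf {n | ExistsPointCompositionN T P n}` (`= Nat.find` on nonempty sets; `0` on the empty set): `minLength_spec`,
  `minLength_le`, `exists_of_minLength_pos`, `minLength_eq_zero_iff`; **`IsShortestFirstCentre T P q`** (a proper closed `q ∈ T` that is the first centre of
  a good composition of length `ℓ`: `.isClosed/.ne_univ/.mem/.minLength_pos`), **`exists_isShortestFirstCentre`** (`0 < ℓ` ⇒ one exists),
  **`IsShortestFirstCentre.minLength_restrict_lt`** (for EVERY blow-up `π₁ : X₁ → X` at such `q`: good compositions over `X₁` exist and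
  `minLength (π₁⁻¹ T) (P.restrict π₁) < minLength T P`), `exists_first_centre_of_minLength_pos` (packaged), `minLength_le_restrict_add_one`.
* §6 THE SNC INSTANCE: `ResolvesToSnc S π := IsStrictNormalCrossingsDivisor X' (π⁻¹ S)`, `isStrictNormalCrossingsDivisor_preimage_hom` (snc along
  isomorphisms), `ResolvesToSnc.isoStable`, `ResolvesToSnc.restrict_eq` (`= ResolvesToSnc (π₁⁻¹ S)`, the total transform), **`sncLength T S := minLength T
  (ResolvesToSnc S)`** = ℓ_T(X, S), `exists_existsPointCompositionN_univ_of_stacks0BIC` (F-75 ⇒ nonempty for `T = univ`, `S = V(Z)`), `sncLength_eq_zero_iff`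
  (`ℓ = 0 ↔ S` is an snc divisor), **`exists_centre_sncLength_preimage_lt`** / **`IsShortestFirstCentre.sncLength_preimage_lt`** (`0 < ℓ_T(X, S)` ⇒ at a
  shortest first centre `q ∈ T`, for every blow-up `π₁ : X₁ → X` at `q`: resolving compositions of `(X₁, π₁⁻¹ S)` over `π₁⁻¹ T` exist and
  `ℓ_{π₁⁻¹T}(X₁, π₁⁻¹ S) < ℓ_T(X, S)`), `sncLength_le_preimage_add_one`.

VACUITY SELF-CHECK. §4–§5 are generic; the `h : ∃ n, …` / `0 < ℓ` binders are inhabited for `T = univ` under F-75's hypotheses by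
`exists_existsPointCompositionN_univ_of_stacks0BIC`, for `T = S` under F-75c (requested); with the set empty `minLength = 0`, `IsShortestFirstCentre` is
empty (`.minLength_pos`) and the descent lemmas are vacuous by their `0 < ℓ` premise (honest: the POINT step then proposes nothing).
-/

noncomputable section

set_option linter.dupNamespace false -- mandated namespace of this single-conjunct summit

open CategoryTheory AlgebraicGeometry TopologicalSpace
open Literature.AlgebraicGeometry.Resolution

namespace Summit.ResolutionOfSingularities.ResolutionOfSingularities.Theorems.SigmaMaxModificationsCorridor3.Sigma

universe u

open Scheme.IdealSheafData

/-! ## §4. Properties of `X`-schemes and good compositions -/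

/-- [OURS · L1 W4.2] A property of `X`-schemes `π : X' → X` (all `X'` of the universe). NOT a statement of the manuscript. [folklore] -/
abbrev OverPred (X : Scheme.{u}) : Type (u + 1) := ∀ ⦃X' : Scheme.{u}⦄, (X' ⟶ X) → Prop

variable {X : Scheme.{u}}

/-- [OURS · L1 W4.2] **Restriction of a property along `π₁ : X₁ → X`**: the `X₁`-scheme `π'` is good iff the `X`-scheme `π' ≫ π₁` is. For the snc
instance this is the TOTAL TRANSFORM (`ResolvesToSnc.restrict_eq`). NOT a statement of the manuscript. [folklore] -/
def OverPred.restrict (P : OverPred X) {X₁ : Scheme.{u}} (π₁ : X₁ ⟶ X) : OverPred X₁ :=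
  fun _ π' => P (π' ≫ π₁)

/-- Unfolding `restrict`. [folklore] -/
@[simp] theorem OverPred.restrict_apply (P : OverPred X) {X₁ X' : Scheme.{u}} (π₁ : X₁ ⟶ X) (π' : X' ⟶ X₁) :
    P.restrict π₁ π' ↔ P (π' ≫ π₁) :=
  Iff.rfl

/-- Restriction is transitive. [folklore] -/
theorem OverPred.restrict_restrict (P : OverPred X) {X₁ X₂ : Scheme.{u}} (π₁ : X₁ ⟶ X) (π₂ : X₂ ⟶ X₁) :
    (P.restrict π₁).restrict π₂ = P.restrict (π₂ ≫ π₁) := by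
  funext X' π'
  simp only [OverPred.restrict, Category.assoc]

/-- [OURS · L1 W4.2] **Stability under isomorphisms of the source**: `P π → P (e.hom ≫ π)`. NOT a statement of the manuscript. [folklore] -/
def OverPred.IsoStable (P : OverPred X) : Prop :=
  ∀ ⦃X' X'' : Scheme.{u}⦄ (e : X'' ≅ X') (π : X' ⟶ X), P π → P (e.hom ≫ π)

/-- An iso-stable property is invariant (both ways) under isomorphisms of the source. [folklore] -/
theorem OverPred.IsoStable.iff (P : OverPred X) (hP : P.IsoStable) {X' X'' : Scheme.{u}} (e : X'' ≅ X') (π : X' ⟶ X) :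
    P (e.hom ≫ π) ↔ P π := by
  refine ⟨fun h => ?_, hP e π⟩
  have h' := hP e.symm (e.hom ≫ π) h
  rwa [Iso.symm_hom, e.inv_hom_id_assoc] at h'

/-- Restriction preserves iso-stability. [folklore] -/
theorem OverPred.IsoStable.restrict {P : OverPred X} (hP : P.IsoStable) {X₁ : Scheme.{u}} (π₁ : X₁ ⟶ X) : (P.restrict π₁).IsoStable :=
  fun _ _ e π' h => by
    change P ((e.hom ≫ π') ≫ π₁)
    rw [Category.assoc]
    exact hP e _ h

/-- [OURS · L1 W4.2] **A good composition of length `n` exists**: some composition `π : X' → X` of exactly `n` point blowing ups over `T` has property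
`P`. NOT a statement of the manuscript. [folklore] -/
def ExistsPointCompositionN (T : Set X) (P : OverPred X) (n : ℕ) : Prop :=
  ∃ (X' : Scheme.{u}) (π : X' ⟶ X), IsPointBlowupCompositionN T n π ∧ P π

namespace ExistsPointCompositionN

variable {T : Set X} {P : OverPred X}

/-- Length `0`: the identity is good. [folklore] -/
theorem zero_iff : ExistsPointCompositionN T P 0 ↔ P (𝟙 X) := by
  constructor
  · rintro ⟨X', π, h, hP⟩
    cases h
    exact hP
  · exact fun h => ⟨X, 𝟙 X, .nil, h⟩

/-- Monotonicity in `T` and `P`. [folklore] -/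
theorem mono {T' : Set X} {P' : OverPred X} (hT : T ⊆ T') (hP : ∀ ⦃X' : Scheme.{u}⦄ (π : X' ⟶ X), P π → P' π) {n : ℕ}
    (h : ExistsPointCompositionN T P n) : ExistsPointCompositionN T' P' n := by
  obtain ⟨X', π, hπ, hPπ⟩ := h
  exact ⟨X', π, hπ.mono hT, hP π hPπ⟩

/-- **First-centre form of length `n + 1`**: a good composition of length `n + 1` over `T` exists iff for some blowing up `π₁ : X₁ → X` at a proper
closed point of `T` a good composition of length `n` over `π₁⁻¹ T` exists for the restricted property. [folklore] -/
theorem succ_iff {n : ℕ} : ExistsPointCompositionN T P (n + 1) ↔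
    ∃ (x : X) (hx : IsClosed ({x} : Set X)) (_ : ({x} : Set X) ≠ Set.univ) (_ : x ∈ T) (X₁ : Scheme.{u}) (π₁ : X₁ ⟶ X)
      (_ : IsBlowup π₁ (vanishingIdeal ⟨{x}, hx⟩)), ExistsPointCompositionN (π₁ ⁻¹' T) (P.restrict π₁) n := by
  constructor
  · rintro ⟨X', π, h, hP⟩
    obtain ⟨x, hx, hne, hT, X₁, π₁, hπ₁, π', hπ', hcomp⟩ := h.exists_first
    exact ⟨x, hx, hne, hT, X₁, π₁, hπ₁, X', π', hπ', by rw [OverPred.restrict_apply, hcomp]; exact hP⟩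
  · rintro ⟨x, hx, hne, hT, X₁, π₁, hπ₁, X', π', hπ', hP⟩
    exact ⟨X', π' ≫ π₁, hπ'.comp_first hx hne hT hπ₁, hP⟩

/-- Going up one blowing up: a good composition of length `n` over the blowing up gives one of length `n + 1` downstairs. [folklore] -/
theorem of_restrict {x : X} (hx : IsClosed ({x} : Set X)) (hne : ({x} : Set X) ≠ Set.univ) (hT : x ∈ T) {X₁ : Scheme.{u}} {π₁ : X₁ ⟶ X}
    (hπ₁ : IsBlowup π₁ (vanishingIdeal ⟨{x}, hx⟩)) {n : ℕ} (h : ExistsPointCompositionN (π₁ ⁻¹' T) (P.restrict π₁) n) :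
    ExistsPointCompositionN T P (n + 1) :=
  succ_iff.mpr ⟨x, hx, hne, hT, X₁, π₁, hπ₁, h⟩

/-- **Base transport of good compositions** along `e : X ≅ Y` (for an iso-stable `P`): the `Y`-property is `P.restrict e.inv`. [folklore] -/
theorem transport (hP : P.IsoStable) {Y : Scheme.{u}} (e : X ≅ Y) {n : ℕ} (h : ExistsPointCompositionN T P n) :
    ExistsPointCompositionN (e.inv ⁻¹' T) (P.restrict e.inv) n := by
  obtain ⟨X', π, hπ, hPπ⟩ := h
  obtain ⟨X'', π'', e', hπ'', hcomm⟩ := hπ.transport e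
  refine ⟨X'', π'', hπ'', ?_⟩
  rw [OverPred.restrict_apply, ← hP.iff _ e', ← Category.assoc, hcomm, Category.assoc, e.hom_inv_id, Category.comp_id]
  exact hPπ

/-- **Change of the model of the first blowing up**: two blowing ups `π₁ : X₁ → X`, `π₁' : X₁' → X` at the same reduced closed point are isomorphic over
`X` (`IsBlowup.unique`), so good compositions of length `n` over one give good compositions of length `n` over the other. [folklore] -/
theorem of_isBlowup_of_isBlowup (hP : P.IsoStable) {x : X} {hx : IsClosed ({x} : Set X)} {X₁ X₁' : Scheme.{u}} {π₁ : X₁ ⟶ X} {π₁' : X₁' ⟶ X}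
    (h₁ : IsBlowup π₁ (vanishingIdeal ⟨{x}, hx⟩)) (h₁' : IsBlowup π₁' (vanishingIdeal ⟨{x}, hx⟩)) {n : ℕ}
    (h : ExistsPointCompositionN (π₁ ⁻¹' T) (P.restrict π₁) n) : ExistsPointCompositionN (π₁' ⁻¹' T) (P.restrict π₁') n := by
  obtain ⟨e, he, he'⟩ := h₁.unique h₁'
  refine (h.transport (hP.restrict π₁) e).mono ?_ ?_
  · intro y hy
    change π₁' y ∈ T
    rw [← he', Scheme.Hom.comp_apply]
    exact hy
  · intro X' ρ hρ
    rw [OverPred.restrict_apply, ← he', ← Category.assoc]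
    exact hρ

end ExistsPointCompositionN

/-! ## §5. The least length -/

/-- [OURS · L1 W4.2] **ℓ — THE LEAST LENGTH of a good composition of point blowing ups over `T`** (`sInf`, i.e. `Nat.find` when some good composition
exists; `0` otherwise). NOT a statement of the manuscript. [folklore] -/
def minLength (T : Set X) (P : OverPred X) : ℕ :=
  sInf {n | ExistsPointCompositionN T P n}

variable {T : Set X} {P : OverPred X}

/-- A good composition of length `ℓ` exists (if any does). [folklore] -/
theorem minLength_spec (h : ∃ n, ExistsPointCompositionN T P n) : ExistsPointCompositionN T P (minLength T P) :=
  Nat.sInf_mem h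

/-- `ℓ` is at most the length of any good composition. [folklore] -/
theorem minLength_le {n : ℕ} (hn : ExistsPointCompositionN T P n) : minLength T P ≤ n :=
  Nat.sInf_le hn

/-- If `0 < ℓ` some good composition exists. [folklore] -/
theorem exists_of_minLength_pos (hpos : 0 < minLength T P) : ∃ n, ExistsPointCompositionN T P n :=
  Nat.nonempty_of_pos_sInf hpos

/-- **`ℓ = 0` iff `X` itself is good** (`P (𝟙 X)`), provided some good composition exists. [folklore] -/
theorem minLength_eq_zero_iff (h : ∃ n, ExistsPointCompositionN T P n) : minLength T P = 0 ↔ P (𝟙 X) := by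
  rw [← ExistsPointCompositionN.zero_iff (T := T) (P := P)]
  refine ⟨fun h0 => h0 ▸ minLength_spec h, fun h0 => Nat.le_zero.mp (minLength_le h0)⟩

/-- [OURS · L1 W4.2] **`q` IS A FIRST CENTRE OF A SHORTEST GOOD COMPOSITION** over `T`: `q` is a proper closed point of `T`, and for some blowing up
`π₁ : X₁ → X` at `q` a good composition over `X₁` (restricted property, locus `π₁⁻¹ T`) of length `ℓ − 1` exists. This is the proposal set of the F-75
POINT step of PHASE B′ (the policy picks one such `q` by its fixed choice). NOT a statement of the manuscript. [folklore] -/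
def IsShortestFirstCentre (T : Set X) (P : OverPred X) (q : X) : Prop :=
  ∃ (hq : IsClosed ({q} : Set X)), ({q} : Set X) ≠ Set.univ ∧ q ∈ T ∧
    ∃ (X₁ : Scheme.{u}) (π₁ : X₁ ⟶ X), IsBlowup π₁ (vanishingIdeal ⟨{q}, hq⟩) ∧
      ∃ n, n + 1 = minLength T P ∧ ExistsPointCompositionN (π₁ ⁻¹' T) (P.restrict π₁) n

/-- A shortest first centre is a closed point. [folklore] -/
theorem IsShortestFirstCentre.isClosed {q : X} (h : IsShortestFirstCentre T P q) : IsClosed ({q} : Set X) :=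
  h.1

/-- A shortest first centre is a proper point. [folklore] -/
theorem IsShortestFirstCentre.ne_univ {q : X} (h : IsShortestFirstCentre T P q) : ({q} : Set X) ≠ Set.univ :=
  h.2.1

/-- A shortest first centre lies in the locus `T`. [folklore] -/
theorem IsShortestFirstCentre.mem {q : X} (h : IsShortestFirstCentre T P q) : q ∈ T :=
  h.2.2.1

/-- A shortest first centre forces `0 < ℓ`. [folklore] -/
theorem IsShortestFirstCentre.minLength_pos {q : X} (h : IsShortestFirstCentre T P q) : 0 < minLength T P := by
  obtain ⟨_, _, _, _, _, _, n, hn, _⟩ := h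
  omega

/-- **Existence: if `0 < ℓ(X)` some point is a first centre of a shortest good composition.** [folklore] -/
theorem exists_isShortestFirstCentre (hpos : 0 < minLength T P) : ∃ q, IsShortestFirstCentre T P q := by
  obtain ⟨m, hm⟩ : ∃ m, minLength T P = m + 1 := ⟨minLength T P - 1, (Nat.succ_pred_eq_of_pos hpos).symm⟩
  have hspec : ExistsPointCompositionN T P (m + 1) := hm ▸ minLength_spec (exists_of_minLength_pos hpos)
  obtain ⟨x, hx, hxne, hxT, X₁, π₁, hπ₁, h₁⟩ := ExistsPointCompositionN.succ_iff.mp hspec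
  exact ⟨x, hx, hxne, hxT, X₁, π₁, hπ₁, m, hm.symm, h₁⟩

/-- **THE DESCENT at a shortest first centre.** For EVERY blowing up `π₁ : X₁ → X` at a shortest first centre `q` (any model — `IsBlowup.unique`; `P`
iso-stable): good compositions over `X₁` exist for the restricted property and **`ℓ(X₁) < ℓ(X)`** (indeed `ℓ(X₁) + 1 ≤ ℓ(X)`). [folklore] -/
theorem IsShortestFirstCentre.minLength_restrict_lt (hP : P.IsoStable) {q : X} (h : IsShortestFirstCentre T P q) {X₁ : Scheme.{u}} (π₁ : X₁ ⟶ X)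
    (hπ₁ : IsBlowup π₁ (vanishingIdeal ⟨{q}, h.isClosed⟩)) :
    (∃ n, ExistsPointCompositionN (π₁ ⁻¹' T) (P.restrict π₁) n) ∧ minLength (π₁ ⁻¹' T) (P.restrict π₁) < minLength T P := by
  obtain ⟨hq, _, _, X₁', π₁', hπ₁', n, hn, h₁'⟩ := h
  have h₁ := ExistsPointCompositionN.of_isBlowup_of_isBlowup hP hπ₁' hπ₁ h₁'
  exact ⟨⟨n, h₁⟩, lt_of_le_of_lt (minLength_le h₁) (by rw [← hn]; exact Nat.lt_succ_self n)⟩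

/-- **THE DESCENT (first centre of a shortest composition), packaged.** If `0 < ℓ(X)`, there is a proper closed point `q ∈ T` such that for EVERY blowing
up `π₁ : X₁ → X` at `q`: good compositions over `X₁` exist for the restricted property, and `ℓ(X₁) < ℓ(X)`. [folklore] -/
theorem exists_first_centre_of_minLength_pos (hP : P.IsoStable) (hpos : 0 < minLength T P) :
    ∃ (q : X) (hq : IsClosed ({q} : Set X)), ({q} : Set X) ≠ Set.univ ∧ q ∈ T ∧
      (∃ (X₁ : Scheme.{u}) (π₁ : X₁ ⟶ X), IsBlowup π₁ (vanishingIdeal ⟨{q}, hq⟩)) ∧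
      ∀ ⦃X₁ : Scheme.{u}⦄ (π₁ : X₁ ⟶ X), IsBlowup π₁ (vanishingIdeal ⟨{q}, hq⟩) →
        (∃ n, ExistsPointCompositionN (π₁ ⁻¹' T) (P.restrict π₁) n) ∧ minLength (π₁ ⁻¹' T) (P.restrict π₁) < minLength T P := by
  obtain ⟨q, h⟩ := exists_isShortestFirstCentre hpos
  obtain ⟨hq, hne, hT, X₁, π₁, hπ₁, -⟩ := id h
  exact ⟨q, hq, hne, hT, ⟨X₁, π₁, hπ₁⟩, fun X₁' π₁' hπ₁' => h.minLength_restrict_lt hP π₁' hπ₁'⟩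

/-- Conversely, one blowing up at a proper closed point of `T` costs at most one: `ℓ(X) ≤ ℓ(X₁) + 1`. [folklore] -/
theorem minLength_le_restrict_add_one {x : X} (hx : IsClosed ({x} : Set X)) (hne : ({x} : Set X) ≠ Set.univ) (hT : x ∈ T)
    {X₁ : Scheme.{u}} {π₁ : X₁ ⟶ X} (hπ₁ : IsBlowup π₁ (vanishingIdeal ⟨{x}, hx⟩))
    (h₁ : ∃ n, ExistsPointCompositionN (π₁ ⁻¹' T) (P.restrict π₁) n) :
    minLength T P ≤ minLength (π₁ ⁻¹' T) (P.restrict π₁) + 1 :=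
  minLength_le (ExistsPointCompositionN.of_restrict hx hne hT hπ₁ (minLength_spec h₁))

/-! ## §6. The snc instance: resolving a closed subset `S` to strict normal crossings (F-75's conclusion, support level) -/

/-- [OURS · L1 W4.2] **`π` resolves `S` to snc**: the total transform `π⁻¹ S` is a strict normal crossings divisor on `X'` — the SUPPORT half of the
conclusion of F-75 `Stacks0BIC_embeddedResolutionCurvesInSurfaces` for `π` and `S = V(Z)` (the Cartier half is not needed for `ℓ`). For PHASE B′,
`S = ⋃_j supp Γ_j` (the filtered boundary traces on the regular surface). NOT a statement of the manuscript. [folklore] -/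
def ResolvesToSnc (S : Set X) : OverPred X :=
  fun X' π => IsStrictNormalCrossingsDivisor X' (π ⁻¹' S)

/-- Unfolding. [folklore] -/
@[simp] theorem resolvesToSnc_iff (S : Set X) {X' : Scheme.{u}} (π : X' ⟶ X) :
    ResolvesToSnc S π ↔ IsStrictNormalCrossingsDivisor X' (π ⁻¹' S) :=
  Iff.rfl

/-- Strict normal crossings divisors are transported along isomorphisms (checked through the open immersion `e.inv`). [folklore] -/
theorem isStrictNormalCrossingsDivisor_preimage_hom {X' X'' : Scheme.{u}} (e : X'' ≅ X') {S : Set X'} (hS : IsStrictNormalCrossingsDivisor X' S) :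
    IsStrictNormalCrossingsDivisor X'' (e.hom ⁻¹' S) := by
  refine IsStrictNormalCrossingsDivisor.of_forall_exists_isOpenImmersion (hS.isClosed.preimage e.hom.continuous) fun q _ => ?_
  refine ⟨X', e.inv, inferInstance, ⟨e.hom q, IsPointBlowupCompositionN.inv_apply_hom_apply e q⟩, ?_⟩
  have hpre : e.inv ⁻¹' (e.hom ⁻¹' S) = S := by
    ext y
    simp only [Set.mem_preimage, IsPointBlowupCompositionN.hom_apply_inv_apply]
  rwa [hpre]

/-- `ResolvesToSnc S` is stable under isomorphisms of the source. [folklore] -/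
theorem ResolvesToSnc.isoStable (S : Set X) : (ResolvesToSnc S).IsoStable := by
  intro X' X'' e π h
  have hpre : (e.hom ≫ π) ⁻¹' S = e.hom ⁻¹' (π ⁻¹' S) := by
    ext y
    simp only [Set.mem_preimage, Scheme.Hom.comp_apply]
  change IsStrictNormalCrossingsDivisor X'' ((e.hom ≫ π) ⁻¹' S)
  rw [hpre]
  exact isStrictNormalCrossingsDivisor_preimage_hom e h

/-- **Restriction = total transform**: `(ResolvesToSnc S).restrict π₁ = ResolvesToSnc (π₁ ⁻¹' S)`. [folklore] -/
theorem ResolvesToSnc.restrict_eq (S : Set X) {X₁ : Scheme.{u}} (π₁ : X₁ ⟶ X) :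
    (ResolvesToSnc S).restrict π₁ = ResolvesToSnc (π₁ ⁻¹' S) := by
  funext X' π'
  have hpre : (π' ≫ π₁) ⁻¹' S = π' ⁻¹' (π₁ ⁻¹' S) := by
    ext y
    simp only [Set.mem_preimage, Scheme.Hom.comp_apply]
  simp only [OverPred.restrict, ResolvesToSnc, hpre]

/-- [OURS · L1 W4.2] **ℓ_T(X, S) — the least number of point blowing ups WITH CENTRES OVER `T` resolving `S` to snc** (`0` if none does). PHASE B′ reads
it with `T = S = ⋃_j supp Γ_j` (centres on the trace configuration: F-75c, the locus form of Stacks 0BIC, makes the set nonempty; with `T = univ` F-75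
itself does — `exists_existsPointCompositionN_univ_of_stacks0BIC`). NOT a statement of the manuscript. [folklore] -/
def sncLength (T S : Set X) : ℕ :=
  minLength T (ResolvesToSnc S)

/-- **F-75 feeds `ℓ_univ`**: under the hypotheses of `Stacks0BIC_embeddedResolutionCurvesInSurfaces` some composition (centres anywhere) resolves `V(Z)`
to snc. [cite: StacksProject, Tag 0BIC (Lemma 54.15.6)] -/
theorem exists_existsPointCompositionN_univ_of_stacks0BIC (hF : Stacks0BIC_embeddedResolutionCurvesInSurfaces.{u}) (X : Scheme.{u}) [IsNoetherian X]
    (Z : X.IdealSheafData) (hreg : Scheme.IsRegular X) (hexc : Scheme.IsExcellent X) (hdim : topologicalKrullDim X = 2)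
    (hZ : IsNowhereDense (Z.support : Set X)) : ∃ n, ExistsPointCompositionN Set.univ (ResolvesToSnc (Z.support : Set X)) n := by
  obtain ⟨X', π, hπ, -, hsnc⟩ := hF X Z hreg hexc hdim hZ
  obtain ⟨n, hn⟩ := IsPointBlowupCompositionN.exists_length hπ
  exact ⟨n, X', π, hn, hsnc⟩

variable {S : Set X}

/-- **`ℓ_T(X, S) = 0` iff `S` is already a strict normal crossings divisor on `X`** (given that some resolving composition over `T` exists). [folklore] -/
theorem sncLength_eq_zero_iff (h : ∃ n, ExistsPointCompositionN T (ResolvesToSnc S) n) :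
    sncLength T S = 0 ↔ IsStrictNormalCrossingsDivisor X S := by
  have hpre : (𝟙 X : X ⟶ X) ⁻¹' S = S := Set.ext fun _ => Iff.rfl
  rw [sncLength, minLength_eq_zero_iff h, resolvesToSnc_iff, hpre]

/-- **THE ℓ-DESCENT OF PHASE B′.** If `0 < ℓ_T(X, S)`, there is a proper closed point `q ∈ T` — a first centre of a shortest resolving composition,
`IsShortestFirstCentre T (ResolvesToSnc S) q` — such that for EVERY blowing up `π₁ : X₁ → X` at `q` (any model, e.g. the strict transform of the surface
in the blown-up ambient): resolving compositions of `(X₁, π₁⁻¹ S)` over `π₁⁻¹ T` exist and **`ℓ_{π₁⁻¹ T}(X₁, π₁⁻¹ S) < ℓ_T(X, S)`**. With `T = S` both loci are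
again «the total transform of `S`», so the measure is read the same way at the next state. [folklore] -/
theorem exists_centre_sncLength_preimage_lt (hpos : 0 < sncLength T S) :
    ∃ (q : X) (hq : IsClosed ({q} : Set X)), ({q} : Set X) ≠ Set.univ ∧ q ∈ T ∧ IsShortestFirstCentre T (ResolvesToSnc S) q ∧
      (∃ (X₁ : Scheme.{u}) (π₁ : X₁ ⟶ X), IsBlowup π₁ (vanishingIdeal ⟨{q}, hq⟩)) ∧
      ∀ ⦃X₁ : Scheme.{u}⦄ (π₁ : X₁ ⟶ X), IsBlowup π₁ (vanishingIdeal ⟨{q}, hq⟩) →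
        (∃ n, ExistsPointCompositionN (π₁ ⁻¹' T) (ResolvesToSnc (π₁ ⁻¹' S)) n) ∧ sncLength (π₁ ⁻¹' T) (π₁ ⁻¹' S) < sncLength T S := by
  obtain ⟨q, h⟩ := exists_isShortestFirstCentre hpos
  obtain ⟨hq, hne, hT, X₁, π₁, hπ₁, -⟩ := id h
  refine ⟨q, hq, hne, hT, h, ⟨X₁, π₁, hπ₁⟩, fun X₁' π₁' hπ₁' => ?_⟩
  have h' := h.minLength_restrict_lt (ResolvesToSnc.isoStable S) π₁' hπ₁'
  rw [ResolvesToSnc.restrict_eq] at h'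
  exact h'

/-- The same at a GIVEN shortest first centre `q` (the one the policy chose). [folklore] -/
theorem IsShortestFirstCentre.sncLength_preimage_lt {q : X} (h : IsShortestFirstCentre T (ResolvesToSnc S) q) {X₁ : Scheme.{u}} (π₁ : X₁ ⟶ X)
    (hπ₁ : IsBlowup π₁ (vanishingIdeal ⟨{q}, h.isClosed⟩)) :
    (∃ n, ExistsPointCompositionN (π₁ ⁻¹' T) (ResolvesToSnc (π₁ ⁻¹' S)) n) ∧ sncLength (π₁ ⁻¹' T) (π₁ ⁻¹' S) < sncLength T S := by
  have h' := h.minLength_restrict_lt (ResolvesToSnc.isoStable S) π₁ hπ₁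
  rw [ResolvesToSnc.restrict_eq] at h'
  exact h'

/-- One blowing up at a proper closed point of `T` costs at most one: `ℓ_T(X, S) ≤ ℓ(X₁, π₁⁻¹ S) + 1`. [folklore] -/
theorem sncLength_le_preimage_add_one {q : X} (hq : IsClosed ({q} : Set X)) (hne : ({q} : Set X) ≠ Set.univ) (hT : q ∈ T)
    {X₁ : Scheme.{u}} {π₁ : X₁ ⟶ X} (hπ₁ : IsBlowup π₁ (vanishingIdeal ⟨{q}, hq⟩))
    (h₁ : ∃ n, ExistsPointCompositionN (π₁ ⁻¹' T) (ResolvesToSnc (π₁ ⁻¹' S)) n) :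
    sncLength T S ≤ sncLength (π₁ ⁻¹' T) (π₁ ⁻¹' S) + 1 := by
  have h := minLength_le_restrict_add_one (P := ResolvesToSnc S) hq hne hT hπ₁ (by rw [ResolvesToSnc.restrict_eq]; exact h₁)
  rwa [ResolvesToSnc.restrict_eq] at h

end Summit.ResolutionOfSingularities.ResolutionOfSingularities.Theorems.SigmaMaxModificationsCorridor3.Sigma

end
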